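import Summits.BirchSwinnertonDyer.Rank1Residual.Additive.RamifiedSevenGenusKatoExpFrame
import Summits.BirchSwinnertonDyer.Rank1Residual.Additive.RamifiedSevenGenusLayerCharacterDirichlet
import Literature.NumberTheory.GaloisRepresentations.CyclotomicCharacterFrobeniusProofs
import Literature.NumberTheory.NumberFields.CongruenceSubgroupTorsionFree
import Mathlib.Analysis.SpecialFunctions.Complex.CircleAddChar
import HarnessLib

set_option autoImplicit false
set_option linter.dupNamespace false

/-!
# Crux `EllipticUnitValueSevenOfGZK` (K7r `RamifiedSevenEllipticUnits` → `X12.CMRamifiedSeven`), row (K2C-6):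
# a REFUTER-GRADE CERTIFICATE that the (C6) hypothesis datum `GenusSeven.DualExpValueDatum hγ Φ` is EMPTY
# (pen D1008 VACUITY / D1009 (5) ask), ideator `bsd-idea-20` g73

**What is proved (sorry-free, standard axioms).**  For every pinned Kato genus frame
`Φ : PinnedKatoGenusFrame W K hK I d` and every `hγ : K.IsTopGenerator γ`:

* `isEmpty_dualExpValueDatum : IsEmpty (GenusSeven.DualExpValueDatum hγ Φ)` (alias `DualExpValueDatum.isEmpty_of_two_twists`,
  the name of the pen's ask); corollaries `not_dualExpCompatShape : ¬ DualExpCompatShape hγ Φ`,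
  `not_exists_dualExpValueDatum : ¬ ∃ D : DualExpValueDatum hγ Φ, P D` (any `P`), `elim_dualExpValueDatum`.

So, as typed in `RamifiedSevenGenusKatoExpFrame.lean` (l.116–166), the datum cannot be inhabited, the predicate
`DualExpCompatShape hγ Φ` (`:= Nonempty (DualExpValueDatum hγ Φ)`, l.170–171) is `False` for every frame, every
theorem taking `(D : DualExpValueDatum hγ Φ)` as a hypothesis is vacuous, and the conjunct `∃ D : DualExpValueDatum hγ Φ, …`
of the registered K2ᶜ stub `stub_integralComparisonInputsSeven` (zp v16, `Lines/kato_perrin_riou_zp.lean` l.544–551) is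
unsatisfiable pointwise in `Φ` — confirming the pen's diagnosis D1008 by a
kernel-checked argument and fixing WHICH field is lethal: the Artin-reciprocity field

  `art : ∀ 𝔟, IsTwist 7 Φ.𝔣 𝔟 → ∀ χ, (∃ n, ∀ σ ∈ κ_L.layerSubgroup n, χ σ = 1) →
          heckeIdealValue χ 𝔟 = ((χ Φ.γK : ℂˣ) : ℂ) ^ artExp 𝔟`,    `artExp : Ideal (𝓞 Φ.Kcm) → ℕ`,

with `κ_L := K.restrictOfFinrankEqTwo _ Φ.Kcm Φ.finrank_Kcm` the cyclotomic `ℤ₇`-extension of `K_cm` and ONE natural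
exponent `artExp 𝔟` serving ALL finite levels at once.  Nothing else of the datum is used (not `val`, `ι₇`, `zStar`, (eV),
(eZ), (psiK)); in particular the repaired row (C6-R) (`artExp : … → ℤ_[7]`-valued / level-wise exponents, pen D1009/D1011)
is NOT touched by this certificate — see §5 of the docstring for the exact boundary.

**The argument (elementary; Frobenius + the cyclotomic character; no `L`-values, no class field theory beyond what the
tree already proves).**  Write `κ = κ_L : Γ_L → ℤ₇` (`L = Φ.Kcm`), `γ = Φ.γK` (`κ γ = 1`).
1. LEVEL CHARACTERS (§1, generic over any field and any `ℤ₇`-extension).  For every `n` there is a continuous character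
   `χ_n : Γ_L →ₜ* ℂˣ`, `χ_n(σ) = e(κ(σ) mod 7ⁿ)` (`ZMod.toCircle ∘ PadicInt.toZModPow n ∘ toAdd ∘ κ`; continuity:
   it is constant on the cosets of the OPEN subgroup `κ.layerSubgroup n`).  It is trivial on `layerSubgroup n`, and
   `χ_n(σ) = χ_n(γ)^a` (read in `ℂ`) forces `κ(σ) ≡ a (mod 7ⁿ)` (`ZMod.injective_toCircle`).
2. THE TOWER (§2, generic over a number field `L ⊇ ℚ` of degree 2 and a CYCLOTOMIC `K`).  `hK : K.IsCyclotomic` says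
   `ker K = χ_cyc⁻¹(torsion)`; with `χ_{cyc,ℚ} ∘ res = χ_{cyc,L}` (tree) this gives: `κ_L τ = 1 ⇒ χ_{cyc,L}(τ)` has
   finite order, and `χ_{cyc,L}(τ) = 1 ⇒ κ_L τ = 1`.  Inertia at a place `v ∤ 7` acts trivially on `7`-power roots of
   unity (tree: `smul_eq_self_of_mem_inertia_of_pow_prime_pow_eq_one`), so `χ_{cyc,L}` and hence every `χ_n` is
   trivial on it: `χ_n` is UNRAMIFIED at `v`, and `heckeIdealValue χ_n 𝔭_v = heckeValueAt χ_n v = χ_n(Frob_v)`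
   (tree: `heckeIdealValue_eq_idealPow`, `idealPow_asIdeal`, `Gross2004.heckeValueAt_eq_of_isUnramifiedAt`).
3. READING `art` AT A PRIME TWIST (§3).  If `art` holds at `𝔟 = 𝔭_v` with exponent `a ∈ ℕ` for all finite-level `χ`,
   then by 1.–2. `κ(Frob_v) ≡ a (mod 7ⁿ)` for every `n`, i.e. `κ(Frob_v) = a` in `ℤ₇` (`PadicInt.ext_of_toZModPow`).
   Moreover `a ≠ 0`: `a = 0` gives `κ(Frob_v) = 0`, so `χ_{cyc,L}(Frob_v) = N v` would have finite order — impossible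
   (tree: `GaloisRep.cyclotomicCharacter_frob_not_isOfFinOrder`).
4. TWO PRIME TWISTS (§4–§5).  `Φ.isTwist_𝔞` forces `Φ.𝔣 ≠ ⊥`, so `M := N(42·𝔣) ≠ 0`; pick rational primes
   `M + 8 ≤ q₁ < q₂` and places `vᵢ ∋ qᵢ` of `L` (tree: `exists_heightOneSpectrum_natCast_mem`).  Then `7 ∉ vᵢ`,
   `N vᵢ = qᵢ^{fᵢ}` with `fᵢ ≥ 1`, and `𝔭_{vᵢ}` IS an admissible twist (`qᵢ ∤ M`, maximality).  With `aᵢ := artExp 𝔭_{vᵢ}`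
   and Frobenii `σᵢ`, step 3 gives `κ(σᵢ) = aᵢ ≥ 1`, so `τ := σ₁^{a₂}·(σ₂^{a₁})⁻¹` has `κ(τ) = a₂a₁ − a₁a₂ = 0`, hence
   `χ_{cyc,L}(τ)^k = 1` for some `k ≥ 1`, i.e. `(N v₁)^{a₂k} = (N v₂)^{a₁k}` in `ℤ₇`, hence in `ℕ`:
   `q₁^{f₁a₂k} = q₂^{f₂a₁k}` with `f₁a₂k ≥ 1` — so `q₁ ∣ q₂`, `q₁ = q₂`, contradiction.

**Why the datum dies and (C6-R) does not (§5 boundary).**  The only input contradicted is «one `a ∈ ℕ` for all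
levels»: Artin reciprocity gives `(𝔭_v, L·ℚ_∞/L) = γ^{κ(Frob_v)}` with `κ(Frob_v) ∈ ℤ₇` a genuine `7`-adic integer
(`= log χ_cyc(Frob_v) / log χ_cyc(γ)` up to the normalisation of `κ`), which is a natural number for at most ONE
residue characteristic (step 4 is exactly the statement that two distinct primes cannot both have natural
coordinates).  A level-wise exponent `a_{𝔟,n} ∈ ℕ` with `χ(𝔟) = χ(γ)^{a_{𝔟,n}}` for `χ` of level `n` (or an exponent
in `ℤ₇` read through `κ`) is consistent — that is the (C6-R) shape — and NOTHING here bears on it.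

**Scope / hygiene.**  Imports: the (C6) frame file, the cell's layer-character file (for `heckeIdealValue_eq_idealPow`
and the Gross–Frobenius dictionary it re-exports), the tree's cyclotomic-Frobenius proofs, one light number-field
file (`exists_heightOneSpectrum_natCast_mem`) and Mathlib's `ZMod.toCircle`.  Theorems only: no `def`, no
`instance`, no `axiom`, no `sorry`, no new hypothesis structure.  It does NOT touch the line of record
`Lines/kato_perrin_riou_zp.lean` (zp v16), registers nothing, and proves no summit / route / crux statement: it is
negative knowledge about ONE hypothesis structure of row (K2C-6), filed at the pen's request (D1009 (5)).

[cite: Kato2004Asterisque, Prop. 15.9 (p. 258) and §15.6 (p. 254) (the admissible twists `𝔞` and `(𝔞, K(p^∞𝔣)/K)`)]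
[cite: Washington1997, §13.1 (ℤ_p-extensions; the cyclotomic one as `χ_cyc` modulo torsion)]
[cite: SerreAbelianLadic1968, Ch. I §1.2 (the cyclotomic character at Frobenius and on inertia)]
[cite: NeukirchANT1999, Ch. VII §10 (10.6) (local factors at unramified primes: value at Frobenius)]
-/

open scoped NumberField
open Field IsDedekindDomain NumberField
open Literature.NumberTheory.GaloisRepresentations
open Literature.NumberTheory.EllipticCurves
open Literature.NumberTheory.LFunctions
open Literature.NumberTheory.ComplexMultiplication.EllipticUnits
open Summit.BirchSwinnertonDyer.Rank1Residual
open Summit.BirchSwinnertonDyer.Rank1Residual.Additive.GenusSeven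

namespace Summit.BirchSwinnertonDyer.BirchSwinnertonDyer.Cruxes.EllipticUnitValueSevenOfGZK.DualExpDatumEmpty

/-! ## §1 Level characters of a `ℤ₇`-extension: `χ_n = e(· mod 7ⁿ) ∘ κ` -/

section LevelCharacter

variable {L : Type} [Field L] (κ : ZpExtension L 7)

/-- On a coset of `layerSubgroup n` the reduction `κ mod 7ⁿ` is constant. [cite: Washington1997, §13.1] -/
theorem toZModPow_toAdd_eq_of_inv_mul_mem {n : ℕ} {σ τ : absoluteGaloisGroup L}
    (h : σ⁻¹ * τ ∈ κ.layerSubgroup n) :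
    PadicInt.toZModPow n (Multiplicative.toAdd (κ τ)) = PadicInt.toZModPow n (Multiplicative.toAdd (κ σ)) := by
  rw [ZpExtension.mem_layerSubgroup, map_mul, map_inv, toAdd_mul, toAdd_inv] at h
  have hker : (-(Multiplicative.toAdd (κ σ)) + Multiplicative.toAdd (κ τ)) ∈
      RingHom.ker (PadicInt.toZModPow (p := 7) n) := by
    rw [PadicInt.ker_toZModPow]
    exact Ideal.mem_span_singleton.mpr h
  rw [RingHom.mem_ker, map_add, map_neg, neg_add_eq_zero] at hker
  exact hker.symm

/-- On `layerSubgroup n` itself the reduction `κ mod 7ⁿ` vanishes. [cite: Washington1997, §13.1] -/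
theorem toZModPow_toAdd_eq_zero_of_mem {n : ℕ} {σ : absoluteGaloisGroup L} (h : σ ∈ κ.layerSubgroup n) :
    PadicInt.toZModPow n (Multiplicative.toAdd (κ σ)) = 0 := by
  rw [ZpExtension.mem_layerSubgroup] at h
  have hker : Multiplicative.toAdd (κ σ) ∈ RingHom.ker (PadicInt.toZModPow (p := 7) n) := by
    rw [PadicInt.ker_toZModPow]
    exact Ideal.mem_span_singleton.mpr h
  exact (RingHom.mem_ker).mp hker

/-- **Level characters exist.**  For every `n` the map `σ ↦ e(κ(σ) mod 7ⁿ) ∈ ℂˣ` (`ZMod.toCircle` of the reduction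
`PadicInt.toZModPow n`) is a CONTINUOUS character of `Γ_L`: a homomorphism because `κ` is one and `toZModPow`,
`toCircle` are (additive-to-multiplicative), and locally constant because it is constant on the cosets of the open
subgroup `layerSubgroup n`. [cite: Washington1997, §13.1] -/
theorem exists_levelCharacter (n : ℕ) :
    ∃ χ : absoluteGaloisGroup L →ₜ* ℂˣ, ∀ σ : absoluteGaloisGroup L,
      χ σ = Circle.toUnits (ZMod.toCircle (N := 7 ^ n) (PadicInt.toZModPow n (Multiplicative.toAdd (κ σ)))) := by
  let f : absoluteGaloisGroup L → ℂˣ := fun σ =>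
    Circle.toUnits (ZMod.toCircle (N := 7 ^ n) (PadicInt.toZModPow n (Multiplicative.toAdd (κ σ))))
  have hf1 : f 1 = 1 := by
    simp only [f, map_one, toAdd_one, map_zero, AddChar.map_zero_eq_one]
  have hfmul : ∀ σ τ : absoluteGaloisGroup L, f (σ * τ) = f σ * f τ := by
    intro σ τ
    simp only [f, map_mul, toAdd_mul, map_add, AddChar.map_add_eq_mul]
  have hflc : IsLocallyConstant f := by
    refine (IsLocallyConstant.iff_exists_open f).mpr fun σ => ?_
    refine ⟨(fun τ => σ⁻¹ * τ) ⁻¹' (κ.layerSubgroup n : Set (absoluteGaloisGroup L)),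
      (κ.isOpen_layerSubgroup n).preimage (continuous_const_mul σ⁻¹), ?_, ?_⟩
    · show σ⁻¹ * σ ∈ κ.layerSubgroup n
      rw [inv_mul_cancel]
      exact Subgroup.one_mem _
    · intro τ hτ
      have hτ' : σ⁻¹ * τ ∈ κ.layerSubgroup n := hτ
      simp only [f, toZModPow_toAdd_eq_of_inv_mul_mem κ hτ']
  exact ⟨{ toFun := f, map_one' := hf1, map_mul' := hfmul, continuous_toFun := hflc.continuous },
    fun σ => rfl⟩

variable {κ}

/-- A level-`n` character is trivial on `layerSubgroup n` (it has finite level `n`). [cite: Washington1997, §13.1] -/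
theorem levelCharacter_eq_one_of_mem {n : ℕ} {χ : absoluteGaloisGroup L →ₜ* ℂˣ}
    (hχ : ∀ σ : absoluteGaloisGroup L,
      χ σ = Circle.toUnits (ZMod.toCircle (N := 7 ^ n) (PadicInt.toZModPow n (Multiplicative.toAdd (κ σ)))))
    {σ : absoluteGaloisGroup L} (hσ : σ ∈ κ.layerSubgroup n) : χ σ = 1 := by
  rw [hχ σ, toZModPow_toAdd_eq_zero_of_mem κ hσ, AddChar.map_zero_eq_one, map_one]

/-- A level-`n` character is trivial wherever `κ` is. [cite: Washington1997, §13.1] -/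
theorem levelCharacter_eq_one_of_apply_eq_one {n : ℕ} {χ : absoluteGaloisGroup L →ₜ* ℂˣ}
    (hχ : ∀ σ : absoluteGaloisGroup L,
      χ σ = Circle.toUnits (ZMod.toCircle (N := 7 ^ n) (PadicInt.toZModPow n (Multiplicative.toAdd (κ σ)))))
    {σ : absoluteGaloisGroup L} (h1 : κ σ = 1) : χ σ = 1 := by
  rw [hχ σ, h1, toAdd_one, map_zero, AddChar.map_zero_eq_one, map_one]

/-- **The exponent law pins the residue.**  If `κ γ = 1` (a topological generator) and `χ_n(σ) = χ_n(γ)^a` in `ℂ`,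
then `κ(σ) ≡ a (mod 7ⁿ)` (`e` is injective on `ℤ/7ⁿ`). [cite: Washington1997, §13.1] -/
theorem toZModPow_toAdd_eq_natCast {n : ℕ} {χ : absoluteGaloisGroup L →ₜ* ℂˣ}
    (hχ : ∀ σ : absoluteGaloisGroup L,
      χ σ = Circle.toUnits (ZMod.toCircle (N := 7 ^ n) (PadicInt.toZModPow n (Multiplicative.toAdd (κ σ)))))
    {γ : absoluteGaloisGroup L} (hγ : κ.IsTopGenerator γ) {σ : absoluteGaloisGroup L} {a : ℕ}
    (h : ((χ σ : ℂˣ) : ℂ) = ((χ γ : ℂˣ) : ℂ) ^ a) :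
    PadicInt.toZModPow n (Multiplicative.toAdd (κ σ)) = (a : ZMod (7 ^ n)) := by
  have hγ' : κ γ = Multiplicative.ofAdd 1 := hγ
  rw [hχ σ, hχ γ, hγ', toAdd_ofAdd, map_one, ← Units.val_pow_eq_pow_val, ← map_pow] at h
  have h' : ZMod.toCircle (N := 7 ^ n) (PadicInt.toZModPow n (Multiplicative.toAdd (κ σ))) =
      (ZMod.toCircle (N := 7 ^ n) 1) ^ a := Circle.ext h
  rw [← AddChar.map_nsmul_eq_pow, nsmul_one] at h'
  exact ZMod.injective_toCircle h'

end LevelCharacter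

/-! ## §2 The cyclotomic `ℤ₇`-tower over a quadratic field: kernel versus `χ_cyc`, inertia away from `7` -/

section Tower

variable {L : Type} [Field L] [NumberField L] (K : ZpExtension ℚ 7) (hK : K.IsCyclotomic)
  (hL : Module.finrank ℚ L = 2) (h72 : (7 : ℕ) ≠ 2)

include hK

/-- `κ_L τ = 1 ⟹ χ_{cyc,L}(τ)` has finite order (`ker K = χ_cyc⁻¹(torsion)`, `χ_{cyc,ℚ} ∘ res = χ_{cyc,L}`).
[cite: Washington1997, §13.1] -/
theorem isOfFinOrder_cyclotomicCharacter_of_restrict_eq_one {τ : absoluteGaloisGroup L}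
    (hτ : K.restrictOfFinrankEqTwo h72 L hL τ = 1) :
    IsOfFinOrder (GaloisRep.cyclotomicCharacter L 7 τ) := by
  have hmem : absGaloisRestrict ℚ L τ ∈ K.kerSubgroup := by
    rw [ZpExtension.mem_kerSubgroup, ← ZpExtension.restrictOfFinrankEqTwo_apply h72 K L hL τ]
    exact hτ
  rw [show K.kerSubgroup = (CommGroup.torsion ℤ_[7]ˣ).comap (GaloisRep.cyclotomicCharacter ℚ 7).toMonoidHom
    from hK, Subgroup.mem_comap] at hmem
  change GaloisRep.cyclotomicCharacter ℚ 7 (absGaloisRestrict ℚ L τ) ∈ CommGroup.torsion ℤ_[7]ˣ at hmem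
  rw [Literature.NumberTheory.GaloisRepresentations.cyclotomicCharacter_absGaloisRestrict ℚ L 7 τ] at hmem
  exact (CommGroup.mem_torsion _).mp hmem

/-- `χ_{cyc,L}(τ) = 1 ⟹ κ_L τ = 1`. [cite: Washington1997, §13.1] -/
theorem restrict_eq_one_of_cyclotomicCharacter_eq_one {τ : absoluteGaloisGroup L}
    (hτ : GaloisRep.cyclotomicCharacter L 7 τ = 1) : K.restrictOfFinrankEqTwo h72 L hL τ = 1 := by
  rw [ZpExtension.restrictOfFinrankEqTwo_apply, ← ZpExtension.mem_kerSubgroup,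
    show K.kerSubgroup = (CommGroup.torsion ℤ_[7]ˣ).comap (GaloisRep.cyclotomicCharacter ℚ 7).toMonoidHom
    from hK, Subgroup.mem_comap]
  change GaloisRep.cyclotomicCharacter ℚ 7 (absGaloisRestrict ℚ L τ) ∈ CommGroup.torsion ℤ_[7]ˣ
  rw [Literature.NumberTheory.GaloisRepresentations.cyclotomicCharacter_absGaloisRestrict ℚ L 7 τ, hτ]
  exact (CommGroup.mem_torsion _).mpr IsOfFinOrder.one

omit hK in
/-- The cyclotomic character is trivial on inertia at a place `v ∤ 7` (inertia fixes the `7`-power roots of unity).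
[cite: SerreAbelianLadic1968, Ch. I §1.2] -/
theorem cyclotomicCharacter_eq_one_of_mem_inertia {v : HeightOneSpectrum (𝓞 L)}
    (hv : ((7 : ℕ) : 𝓞 L) ∉ v.asIdeal) {𝔓 : Ideal (absIntegers (𝓞 L) L)} (h𝔓 : 𝔓 ∈ v.primesAbove)
    {τ : absoluteGaloisGroup L} (hτ : τ ∈ 𝔓.inertia (absoluteGaloisGroup L)) :
    GaloisRep.cyclotomicCharacter L 7 τ = 1 := by
  rw [GaloisRep.cyclotomicCharacter_apply]
  exact cyclotomicCharacter_eq_one_of_forall_pow_eq_one 7 _ fun _ _ ht =>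
    smul_eq_self_of_mem_inertia_of_pow_prime_pow_eq_one hv h𝔓 hτ ht

/-! ## §3 Reading an `ℕ`-valued Artin exponent at a prime twist: `κ_L(Frob_v) = a` in `ℤ₇`, and `a ≠ 0` -/

/-- **Frobenius reading of the exponent law.**  If every finite-level character `χ` of the tower satisfies
`heckeIdealValue χ 𝔭_v = χ(γ)^a` (one `a ∈ ℕ` for all levels), `v ∤ 7`, then `κ_L(Frob_v) = a` in `ℤ₇`.
[cite: NeukirchANT1999, Ch. VII §10 (10.6)] [cite: Washington1997, §13.1] -/
theorem toAdd_restrict_frob_eq_natCast {γ : absoluteGaloisGroup L}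
    (hγ : (K.restrictOfFinrankEqTwo h72 L hL).IsTopGenerator γ)
    {v : HeightOneSpectrum (𝓞 L)} (hv : ((7 : ℕ) : 𝓞 L) ∉ v.asIdeal)
    {𝔓 : Ideal (absIntegers (𝓞 L) L)} (h𝔓 : 𝔓 ∈ v.primesAbove)
    {σ : absoluteGaloisGroup L} (hσ : IsArithFrobAt (𝓞 L) σ 𝔓) {a : ℕ}
    (hart : ∀ χ : absoluteGaloisGroup L →ₜ* ℂˣ,
      (∃ n : ℕ, ∀ τ ∈ (K.restrictOfFinrankEqTwo h72 L hL).layerSubgroup n, χ τ = 1) →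
        heckeIdealValue χ v.asIdeal = ((χ γ : ℂˣ) : ℂ) ^ a) :
    Multiplicative.toAdd ((K.restrictOfFinrankEqTwo h72 L hL) σ) = (a : ℤ_[7]) := by
  refine PadicInt.ext_of_toZModPow.mp fun n => ?_
  rw [map_natCast]
  obtain ⟨χ, hχ⟩ := exists_levelCharacter (K.restrictOfFinrankEqTwo h72 L hL) n
  have hlev : ∀ τ ∈ (K.restrictOfFinrankEqTwo h72 L hL).layerSubgroup n, χ τ = 1 :=
    fun τ hτ => levelCharacter_eq_one_of_mem hχ hτ
  have hur : GaloisRep.IsUnramifiedAt v (FramedArtinRep.toArtinRep (FramedRep.ofCharacter χ)) := by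
    refine (Gross2004.isUnramifiedAt_ofCharacter_iff χ v).mpr fun 𝔓' h𝔓' τ hτ => ?_
    exact levelCharacter_eq_one_of_apply_eq_one hχ
      (restrict_eq_one_of_cyclotomicCharacter_eq_one K hK hL h72
        (cyclotomicCharacter_eq_one_of_mem_inertia hv h𝔓' hτ))
  have hval : heckeIdealValue χ v.asIdeal = ((χ σ : ℂˣ) : ℂ) := by
    rw [LayerCharacter.heckeIdealValue_eq_idealPow χ v.ne_bot, idealPow_asIdeal,
      Gross2004.heckeValueAt_eq_of_isUnramifiedAt χ hur h𝔓 hσ]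
  have h := hart χ ⟨n, hlev⟩
  rw [hval] at h
  exact toZModPow_toAdd_eq_natCast hχ hγ h

/-- … and then `a ≠ 0`: `a = 0` would make `χ_{cyc,L}(Frob_v) = N v` of finite order. [cite: SerreAbelianLadic1968, Ch. I §1.2] -/
theorem artinExponent_ne_zero {γ : absoluteGaloisGroup L}
    (hγ : (K.restrictOfFinrankEqTwo h72 L hL).IsTopGenerator γ)
    {v : HeightOneSpectrum (𝓞 L)} (hv : ((7 : ℕ) : 𝓞 L) ∉ v.asIdeal)
    {𝔓 : Ideal (absIntegers (𝓞 L) L)} (h𝔓 : 𝔓 ∈ v.primesAbove)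
    {σ : absoluteGaloisGroup L} (hσ : IsArithFrobAt (𝓞 L) σ 𝔓) {a : ℕ}
    (hart : ∀ χ : absoluteGaloisGroup L →ₜ* ℂˣ,
      (∃ n : ℕ, ∀ τ ∈ (K.restrictOfFinrankEqTwo h72 L hL).layerSubgroup n, χ τ = 1) →
        heckeIdealValue χ v.asIdeal = ((χ γ : ℂˣ) : ℂ) ^ a) :
    a ≠ 0 := by
  intro h0
  refine GaloisRep.cyclotomicCharacter_frob_not_isOfFinOrder hv h𝔓 hσ
    (isOfFinOrder_cyclotomicCharacter_of_restrict_eq_one K hK hL h72 ?_)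
  apply Multiplicative.toAdd.injective
  rw [toAdd_restrict_frob_eq_natCast K hK hL h72 hγ hv h𝔓 hσ hart, h0, Nat.cast_zero, toAdd_one]

/-! ## §4 Prime admissible twists away from `42·𝔣` -/

omit hK in
/-- The residue cardinality of a place `v ∋ q` (`q` a rational prime) is a positive power of `q`
(`N v ∣ N(q) = q^{[L:ℚ]}`). [cite: NeukirchANT1999, Ch. I §8 (8.2)] -/
theorem residueCard_eq_prime_pow_of_natCast_mem {q : ℕ} (hq : q.Prime) (v : HeightOneSpectrum (𝓞 L))
    (hqv : (q : 𝓞 L) ∈ v.asIdeal) : ∃ i : ℕ, 0 < i ∧ v.residueCard = q ^ i := by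
  have hle : Ideal.span {(q : 𝓞 L)} ≤ v.asIdeal := (Ideal.span_singleton_le_iff_mem _).mpr hqv
  have hd : Ideal.absNorm v.asIdeal ∣ Ideal.absNorm (Ideal.span {(q : 𝓞 L)}) :=
    Ideal.absNorm_dvd_absNorm_of_le hle
  rw [Ideal.absNorm_span_singleton, ← map_natCast (algebraMap ℤ (𝓞 L)) q, Algebra.norm_algebraMap,
    Int.natAbs_pow, Int.natAbs_natCast] at hd
  obtain ⟨i, -, hi⟩ := (Nat.dvd_prime_pow hq).mp hd
  refine ⟨i, Nat.pos_of_ne_zero ?_, hi⟩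
  rintro rfl
  have h1 := v.one_lt_residueCard
  have h1' : v.residueCard = 1 := by rw [← pow_zero q]; exact hi
  omega

omit [NumberField L] hK in
/-- A place `v ∋ q` contains no natural number prime to `q`. [cite: NeukirchANT1999, Ch. I §8] -/
theorem natCast_not_mem_of_coprime {q m : ℕ} (v : HeightOneSpectrum (𝓞 L)) (hqv : (q : 𝓞 L) ∈ v.asIdeal)
    (h : Nat.Coprime q m) : (m : 𝓞 L) ∉ v.asIdeal := by
  intro hm
  obtain ⟨a, b, hab⟩ := Nat.isCoprime_iff_coprime.mpr h
  have e : (a : 𝓞 L) * (q : 𝓞 L) + (b : 𝓞 L) * (m : 𝓞 L) = 1 := by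
    have := congrArg (Int.cast : ℤ → 𝓞 L) hab
    push_cast at this
    exact this
  have h1 : (1 : 𝓞 L) ∈ v.asIdeal := by
    rw [← e]
    exact Ideal.add_mem _ (Ideal.mul_mem_left _ _ hqv) (Ideal.mul_mem_left _ _ hm)
  exact v.isPrime.ne_top ((Ideal.eq_top_iff_one _).mpr h1)

omit hK in
/-- **A prime `𝔭_v ∋ q` with `q ∤ N(42·𝔣)` is an admissible twist** (`IsTwist 7 𝔣 𝔭_v`: prime to `6·7·𝔣` by
maximality and norms, and `≠ O_L`). [cite: Kato2004Asterisque, §15.6 (p. 254)] -/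
theorem isTwist_asIdeal_of_not_dvd {𝔣 : Ideal (𝓞 L)} {q : ℕ} (hq : q.Prime) (v : HeightOneSpectrum (𝓞 L))
    (hqv : (q : 𝓞 L) ∈ v.asIdeal) (hqM : ¬ q ∣ Ideal.absNorm (katoModulus6 7 𝔣)) :
    IsTwist 7 𝔣 v.asIdeal := by
  refine ⟨?_, v.isPrime.ne_top⟩
  rw [Ideal.isCoprime_iff_sup_eq]
  by_contra hne
  have hle : katoModulus6 7 𝔣 ≤ v.asIdeal :=
    le_sup_right.trans (v.isMaximal.eq_of_le hne le_sup_left).symm.le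
  obtain ⟨i, hi, hci⟩ := residueCard_eq_prime_pow_of_natCast_mem hq v hqv
  have hq' : q ∣ Ideal.absNorm v.asIdeal := by
    change q ∣ v.residueCard
    rw [hci]
    exact dvd_pow_self q hi.ne'
  exact hqM (hq'.trans (Ideal.absNorm_dvd_absNorm_of_le hle))

end Tower

/-! ## §5 The certificate: `DualExpValueDatum hγ Φ` is empty -/

section Main

variable {W : WeierstrassCurve ℚ} [W.IsElliptic] [W.IsGloballyMinimal] [Fact (Nat.Prime 7)]
  [ContinuousSMul ℤ_[7] (W.tateModule 7)] {K : ZpExtension ℚ 7} {hK : K.IsCyclotomic}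
  {γ : Field.absoluteGaloisGroup ℚ} {I : Kato2004.IwasawaH1Data W 7 K γ}
  {F : GenusFrame} {θu : ∀ n : ℕ, globalUnitsOf (F.layer n)} {d : GenusDatum F θu}

/-- The conductor ideal of a Kato genus frame is nonzero (it admits the twist `Φ.𝔞`: `IsTwist 7 ⊥ 𝔞` forces `𝔞 = ⊤`).
[cite: Kato2004Asterisque, §15.6 (p. 254)] -/
theorem frame_𝔣_ne_bot (Φ : PinnedKatoGenusFrame W K hK I d) : Φ.𝔣 ≠ ⊥ := by
  intro h
  have ht : IsTwist 7 Φ.𝔣 Φ.𝔞 := Φ.isTwist_𝔞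
  have h1 : IsCoprime Φ.𝔞 (katoModulus6 7 Φ.𝔣) := ht.isCoprime
  rw [h, katoModulus6, Ideal.mul_bot, ← Ideal.zero_eq_bot, isCoprime_zero_right, Ideal.isUnit_iff] at h1
  exact ht.ne_top h1

/-- `N(42·𝔣) ≠ 0` for a Kato genus frame. [cite: Kato2004Asterisque, §15.6 (p. 254)] -/
theorem absNorm_katoModulus6_ne_zero (Φ : PinnedKatoGenusFrame W K hK I d) :
    Ideal.absNorm (katoModulus6 7 Φ.𝔣) ≠ 0 := by
  rw [Ne, Ideal.absNorm_eq_zero_iff, katoModulus6, Ideal.mul_eq_bot, not_or]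
  refine ⟨?_, frame_𝔣_ne_bot Φ⟩
  rw [Ideal.span_singleton_eq_bot]
  exact_mod_cast (show (6 * 7 : ℕ) ≠ 0 by decide)

/-- **CERTIFICATE (pen D1008/D1009 (5)).  The (C6) hypothesis datum is empty:** `IsEmpty (DualExpValueDatum hγ Φ)` for
every pinned Kato genus frame `Φ` and every `hγ`.  Only the field `art` (one exponent `artExp 𝔟 ∈ ℕ` for all finite
levels) is used, read at two prime admissible twists of distinct residue characteristics (module docstring, steps 1–4).
[cite: Kato2004Asterisque, Prop. 15.9 (p. 258), §15.6 (p. 254)] [cite: Washington1997, §13.1]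
[cite: SerreAbelianLadic1968, Ch. I §1.2] [cite: NeukirchANT1999, Ch. VII §10 (10.6)] -/
theorem isEmpty_dualExpValueDatum (hγ : K.IsTopGenerator γ) (Φ : PinnedKatoGenusFrame W K hK I d) :
    IsEmpty (DualExpValueDatum hγ Φ) := by
  refine ⟨fun D => ?_⟩
  -- (1) the Kato modulus `42·𝔣` has nonzero norm `M`
  have hM0 : Ideal.absNorm (katoModulus6 7 Φ.𝔣) ≠ 0 := absNorm_katoModulus6_ne_zero Φ
  -- (2) two rational primes `M + 8 ≤ q₁ < q₂`
  obtain ⟨q₁, hq₁M, hq₁⟩ := Nat.exists_infinite_primes (Ideal.absNorm (katoModulus6 7 Φ.𝔣) + 8)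
  obtain ⟨q₂, hq₂M, hq₂⟩ := Nat.exists_infinite_primes (q₁ + 1)
  have hq₁nd : ¬ q₁ ∣ Ideal.absNorm (katoModulus6 7 Φ.𝔣) := fun h => by
    have := Nat.le_of_dvd (Nat.pos_of_ne_zero hM0) h
    omega
  have hq₂nd : ¬ q₂ ∣ Ideal.absNorm (katoModulus6 7 Φ.𝔣) := fun h => by
    have := Nat.le_of_dvd (Nat.pos_of_ne_zero hM0) h
    omega
  have hq₁7 : Nat.Coprime q₁ 7 := (Nat.coprime_primes hq₁ (by norm_num)).mpr (by omega)
  have hq₂7 : Nat.Coprime q₂ 7 := (Nat.coprime_primes hq₂ (by norm_num)).mpr (by omega)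
  have hq12 : q₁ ≠ q₂ := by omega
  -- (3) places `vᵢ ∋ qᵢ` of `L = Φ.Kcm`: admissible twists away from `7`
  obtain ⟨v₁, hv₁⟩ :=
    Literature.NumberTheory.NumberFields.RingOfIntegers.exists_heightOneSpectrum_natCast_mem Φ.Kcm hq₁
  obtain ⟨v₂, hv₂⟩ :=
    Literature.NumberTheory.NumberFields.RingOfIntegers.exists_heightOneSpectrum_natCast_mem Φ.Kcm hq₂
  have h7v₁ : ((7 : ℕ) : 𝓞 Φ.Kcm) ∉ v₁.asIdeal := natCast_not_mem_of_coprime v₁ hv₁ hq₁7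
  have h7v₂ : ((7 : ℕ) : 𝓞 Φ.Kcm) ∉ v₂.asIdeal := natCast_not_mem_of_coprime v₂ hv₂ hq₂7
  have htw₁ : IsTwist 7 Φ.𝔣 v₁.asIdeal := isTwist_asIdeal_of_not_dvd hq₁ v₁ hv₁ hq₁nd
  have htw₂ : IsTwist 7 Φ.𝔣 v₂.asIdeal := isTwist_asIdeal_of_not_dvd hq₂ v₂ hv₂ hq₂nd
  -- (4) Frobenii
  obtain ⟨𝔓₁, h𝔓₁⟩ := v₁.primesAbove_nonempty
  obtain ⟨𝔓₂, h𝔓₂⟩ := v₂.primesAbove_nonempty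
  obtain ⟨σ₁, hσ₁⟩ := HeightOneSpectrum.exists_isArithFrobAt_of_mem_primesAbove_holds h𝔓₁
  obtain ⟨σ₂, hσ₂⟩ := HeightOneSpectrum.exists_isArithFrobAt_of_mem_primesAbove_holds h𝔓₂
  -- (5) `art` read at the two twists: `κ_L(σᵢ) = aᵢ ∈ ℕ`, `aᵢ ≠ 0`
  have hart₁ := fun (χ : absoluteGaloisGroup Φ.Kcm →ₜ* ℂˣ)
      (hχ : ∃ n : ℕ, ∀ τ ∈ (K.restrictOfFinrankEqTwo (by decide) Φ.Kcm Φ.finrank_Kcm).layerSubgroup n, χ τ = 1) =>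
    D.art v₁.asIdeal htw₁ χ hχ
  have hart₂ := fun (χ : absoluteGaloisGroup Φ.Kcm →ₜ* ℂˣ)
      (hχ : ∃ n : ℕ, ∀ τ ∈ (K.restrictOfFinrankEqTwo (by decide) Φ.Kcm Φ.finrank_Kcm).layerSubgroup n, χ τ = 1) =>
    D.art v₂.asIdeal htw₂ χ hχ
  have key₁ := toAdd_restrict_frob_eq_natCast K hK Φ.finrank_Kcm (by decide) Φ.isTopGenerator_γK h7v₁ h𝔓₁ hσ₁ hart₁
  have key₂ := toAdd_restrict_frob_eq_natCast K hK Φ.finrank_Kcm (by decide) Φ.isTopGenerator_γK h7v₂ h𝔓₂ hσ₂ hart₂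
  have ha₁ := artinExponent_ne_zero K hK Φ.finrank_Kcm (by decide) Φ.isTopGenerator_γK h7v₁ h𝔓₁ hσ₁ hart₁
  have ha₂ := artinExponent_ne_zero K hK Φ.finrank_Kcm (by decide) Φ.isTopGenerator_γK h7v₂ h𝔓₂ hσ₂ hart₂
  -- (6) `τ := σ₁^{a₂}·(σ₂^{a₁})⁻¹` lies in the kernel of `κ_L`, so `χ_cyc(τ)` has finite order `k`
  have hτ : (K.restrictOfFinrankEqTwo (by decide) Φ.Kcm Φ.finrank_Kcm)
      (σ₁ ^ D.artExp v₂.asIdeal * (σ₂ ^ D.artExp v₁.asIdeal)⁻¹) = 1 := by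
    apply Multiplicative.toAdd.injective
    rw [map_mul, map_inv, map_pow, map_pow, toAdd_mul, toAdd_inv, toAdd_pow, toAdd_pow, key₁, key₂, toAdd_one]
    simp only [nsmul_eq_mul]
    ring
  obtain ⟨k, hk, hpow⟩ :=
    (isOfFinOrder_cyclotomicCharacter_of_restrict_eq_one K hK Φ.finrank_Kcm (by decide) hτ).exists_pow_eq_one
  rw [map_mul, map_inv, map_pow, map_pow, mul_pow, inv_pow, mul_inv_eq_one, ← pow_mul, ← pow_mul] at hpow
  -- (7) `(N v₁)^{a₂k} = (N v₂)^{a₁k}` in `ℤ₇`, hence in `ℕ`; residue cardinalities are prime powers: contradiction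
  have hN : ((v₁.residueCard : ℕ) : ℤ_[7]) ^ (D.artExp v₂.asIdeal * k) =
      ((v₂.residueCard : ℕ) : ℤ_[7]) ^ (D.artExp v₁.asIdeal * k) := by
    have h := congrArg (fun u : ℤ_[7]ˣ => (u : ℤ_[7])) hpow
    simpa only [Units.val_pow_eq_pow_val, GaloisRep.cyclotomicCharacter_apply_of_isArithFrobAt h7v₁ h𝔓₁ hσ₁,
      GaloisRep.cyclotomicCharacter_apply_of_isArithFrobAt h7v₂ h𝔓₂ hσ₂] using h
  have hN' : v₁.residueCard ^ (D.artExp v₂.asIdeal * k) = v₂.residueCard ^ (D.artExp v₁.asIdeal * k) := by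
    exact_mod_cast hN
  obtain ⟨i₁, hi₁, hc₁⟩ := residueCard_eq_prime_pow_of_natCast_mem hq₁ v₁ hv₁
  obtain ⟨i₂, hi₂, hc₂⟩ := residueCard_eq_prime_pow_of_natCast_mem hq₂ v₂ hv₂
  rw [hc₁, hc₂, ← pow_mul, ← pow_mul] at hN'
  have hdvd : q₁ ∣ q₂ ^ (i₂ * (D.artExp v₁.asIdeal * k)) := by
    rw [← hN']
    exact dvd_pow_self q₁ (mul_ne_zero hi₁.ne' (mul_ne_zero ha₂ hk.ne'))
  exact hq12 ((Nat.prime_dvd_prime_iff_eq hq₁ hq₂).mp (hq₁.dvd_of_dvd_pow hdvd))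

/-- Alias under the name the pen asked for (D1009 (5): `DualExpValueDatum.isEmpty_of_two_twists`), inside this crux
namespace (no squatting of the cell's `GenusSeven.DualExpValueDatum` namespace). [cite: Kato2004Asterisque, Prop. 15.9 (p. 258)] -/
theorem DualExpValueDatum.isEmpty_of_two_twists (hγ : K.IsTopGenerator γ) (Φ : PinnedKatoGenusFrame W K hK I d) :
    IsEmpty (DualExpValueDatum hγ Φ) :=
  isEmpty_dualExpValueDatum hγ Φ

/-- Corollary: the (C6) predicate `DualExpCompatShape hγ Φ` (`:= Nonempty (DualExpValueDatum hγ Φ)`, ExpFrame l.170–171)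
is FALSE for every pinned frame. [cite: Kato2004Asterisque, Prop. 15.9 (p. 258)] -/
theorem not_dualExpCompatShape (hγ : K.IsTopGenerator γ) (Φ : PinnedKatoGenusFrame W K hK I d) :
    ¬ DualExpCompatShape hγ Φ :=
  not_nonempty_iff.mpr (isEmpty_dualExpValueDatum hγ Φ)

/-- Corollary: no existential over the datum can hold — in particular the conjunct
`∃ D : GenusSeven.DualExpValueDatum hγ Φ, …` in the conclusion of the registered K2ᶜ stub
`stub_integralComparisonInputsSeven` of `Lines/kato_perrin_riou_zp.lean` (zp v16, l.544–551) is unsatisfiable for every `Φ`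
(so that stub can hold only vacuously in `d : GenusDatum F θu`; re-pointing it at the repaired row (C6-R) is the pen's
D1009/D1011 plan, untouched here). [cite: Kato2004Asterisque, (15.16.1) (p. 265)] -/
theorem not_exists_dualExpValueDatum (hγ : K.IsTopGenerator γ) (Φ : PinnedKatoGenusFrame W K hK I d)
    (P : DualExpValueDatum hγ Φ → Prop) : ¬ ∃ D : DualExpValueDatum hγ Φ, P D :=
  fun ⟨D, _⟩ => (isEmpty_dualExpValueDatum hγ Φ).false D

/-- Corollary: any statement follows from a (C6) datum (every `(D : DualExpValueDatum hγ Φ) → …` theorem of the cell —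
e.g. `integralComparisonShape_of_inputs`, `periodScaledComparisonShape_of_inputs` — is vacuously true).
[cite: Kato2004Asterisque, Prop. 15.9 (p. 258)] -/
theorem elim_dualExpValueDatum (hγ : K.IsTopGenerator γ) (Φ : PinnedKatoGenusFrame W K hK I d)
    (D : DualExpValueDatum hγ Φ) (P : Prop) : P :=
  (isEmpty_dualExpValueDatum hγ Φ).elim D

end Main

end Summit.BirchSwinnertonDyer.BirchSwinnertonDyer.Cruxes.EllipticUnitValueSevenOfGZK.DualExpDatumEmpty
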